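import Literature.Analysis.FunctionSpaces.TorusFractionalSobolevEmbedding
import HarnessLib

/-!
# The homogeneous Sobolev scale on the torus is monotone; smooth fields lie in every `Ḣ^s`

Analysis/FunctionSpaces support file (everything proved; no definitions, no named facts). Two elementary
facts about the tree's spectral homogeneous seminorm on the unit flat torus `T^d = (ℝ/ℤ)^d`,
`|f|_{Ḣ^s} = (∑_{k ≠ 0} |k|^{2s} ‖f̂(k)‖²)^{1/2}` (`Torus.eHomSobolevSeminorm`, `TorusSobolevNorm.lean`):

* `Torus.eHomSobolevSeminorm_mono` — **monotonicity of the scale**: `|f|_{Ḣ^{s'}} ≤ |f|_{Ḣ^s}` for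
  `s' ≤ s` and EVERY `f` — on the integer lattice every non-zero frequency has `|k| ≥ 1`, so the weights
  `|k|^{2s}` increase with `s` (Bahouri–Chemin–Danchin 2011, §1.4 / Remark after Def. 1.3.4 for the torus:
  `Ḣ^s(T^d) ⊂ Ḣ^{s'}(T^d)` for `s' ≤ s`, in contrast with `ℝ^d`; the Poincaré chain
  `λ₁^{m}‖u‖²_{Ḣ^{s'}} ≤ ‖u‖²_{Ḣ^{s'+m}}` of Temam 1995, §2.1 is the same inequality with the
  factor `4π²` of the Stokes eigenvalues made explicit). Companion of the inhomogeneous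
  `Torus.eSobolevNorm_mono`.
* `Torus.IsSmooth.eHomSobolevSeminorm_complexify_lt_top` — **smooth real vector fields have finite
  `Ḣ^s` seminorm for every real `s`** (rapid decay of the Fourier coefficients, Grafakos 2014, Thm 3.3.9;
  tree `Torus.IsSmooth.summable_freqNormSq_rpow_mul_norm_sq` for `s > 0`, and monotonicity for `s ≤ 1`).

Used by the NS-CLAIMS cell (D-0090) for Poincaré-chain steps stated in the `‖u‖_r = |A^{r/2}u|` norms of
periodic claims (e.g. `Literature.Claims.NS.Li2013b.Step2_Poincare40`), and generally wherever a
claim's `H^r`-energy bookkeeping has to be typed on the torus.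

[cite: BahouriCheminDanchin2011, §1.4 (homogeneous spaces on the torus)] [cite: Grafakos2014, Thm. 3.3.9]

WHAT THIS IS NOT: not a claim about NS regularity or blow-up; not a claim about any author beyond the
typed locator.
-/

noncomputable section

open MeasureTheory Set Real UnitAddTorus
open scoped ENNReal NNReal

namespace Literature.Analysis.FunctionSpaces

namespace Torus

variable {d : Type*} [Fintype d]

section Mono

variable {F : Type*} [NormedAddCommGroup F] [NormedSpace ℂ F]

/-- **Monotonicity of the homogeneous scale on the torus**: `|f|_{Ḣ^{s'}} ≤ |f|_{Ḣ^s}` for `s' ≤ s`,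
for every `f : T^d → F` (no integrability needed: the inequality is termwise on the defining series —
the zero mode is omitted on both sides and `|k|² ≥ 1` for `k ≠ 0`, so `|k|^{2s'} ≤ |k|^{2s}`).
[cite: BahouriCheminDanchin2011, §1.4 (homogeneous spaces on the torus)] -/
theorem eHomSobolevSeminorm_mono {s s' : ℝ} (h : s' ≤ s) (f : UnitAddTorus d → F) :
    eHomSobolevSeminorm s' f ≤ eHomSobolevSeminorm s f := by
  unfold eHomSobolevSeminorm
  refine ENNReal.rpow_le_rpow (ENNReal.tsum_le_tsum fun k => ?_) (by norm_num)
  by_cases hk : k = 0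
  · simp [hk]
  · rw [if_neg hk, if_neg hk]
    exact mul_le_mul_left
      (ENNReal.ofReal_le_ofReal
        (Real.rpow_le_rpow_of_exponent_le (one_le_freqNormSq_of_ne_zero hk) h)) _

end Mono

/-- **Smooth real vector fields on the torus have finite `Ḣ^s` seminorm for every `s`**: for `s > 0`
the series `∑_k |k|^{2s}‖û(k)‖²` converges by the rapid decay of the coefficients of a smooth field,
and for `s ≤ 1` one compares with `s = 1` by `eHomSobolevSeminorm_mono`.
[cite: Grafakos2014, Thm. 3.3.9] -/
theorem IsSmooth.eHomSobolevSeminorm_complexify_lt_top [DecidableEq d]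
    {u : UnitAddTorus d → EuclideanSpace ℝ d} (hu : IsSmooth u) (s : ℝ) :
    eHomSobolevSeminorm s (EuclideanSpace.complexify ∘ u) < ∞ := by
  -- reduce to a positive exponent
  have key : ∀ t : ℝ, 0 < t → eHomSobolevSeminorm t (EuclideanSpace.complexify ∘ u) < ∞ := by
    intro t ht
    have hsum := hu.summable_freqNormSq_rpow_mul_norm_sq ht.le
    have hsq := eHomSobolevSeminorm_complexify_sq_eq_ofReal_tsum ht hsum
    have hne : eHomSobolevSeminorm t (EuclideanSpace.complexify ∘ u) ^ 2 ≠ ∞ := by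
      rw [hsq]; exact ENNReal.ofReal_ne_top
    exact lt_top_iff_ne_top.2 fun htop => hne (by rw [htop]; simp)
  by_cases hs : 0 < s
  · exact key s hs
  · exact (eHomSobolevSeminorm_mono ((not_lt.1 hs).trans zero_le_one) _).trans_lt (key 1 one_pos)

end Torus

end Literature.Analysis.FunctionSpaces
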